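import Literature.Geometry.Riemannian.ShrinkerPotentialProper
import HarnessLib

/-!
# Stub `helper_mwPotentialProper` of line `collapsed-ends-usc` (crux
# `EntropyRung.NoncompactShrinkerGap`, stmt-SmoothPoincare4-10868): the potential of a complete
# gradient shrinker is proper

Registered helper stub (S7 of the Munteanu–Wang 2015, Thm. 1.4 programme of lead c14: the
localised maximum principle takes maxima of `Θ_A(f) · u` over the compact sub-level sets
`{f ≤ 2A}`): on a complete (closed metric balls compact) connected gradient shrinking Ricci
soliton `Ric + Hess f = ½ g` of any dimension `n`, with smooth potential normalised by
`R + |∇f|² = f` and `R ≥ 0`, every sub-level set `{f ≤ c}` is compact (Haslhofer–Müller 2011,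
Lemma 2.1). This is VERBATIM the Literature theorem `Shrinker.isCompact_potential_le`
(`Literature/Geometry/Riemannian/ShrinkerPotentialProper.lean`) at the model `𝓡 n`. Everything
is proved; no definition and no named fact is introduced.

## References

* [HaslhoferMuller2011] R. Haslhofer, R. Müller, *A compactness theorem for complete Ricci
  shrinkers*, GAFA 21 (2011) 1091–1116 = arXiv:1005.3255, Lemma 2.1 (p. 5).
-/

noncomputable section

-- `Summit.SmoothPoincare4.SmoothPoincare4.…` (summit = problem) trips `dupNamespace` on every decl.
set_option linter.dupNamespace false

open scoped Manifold ContDiff Topology NNReal ENNReal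
open Set Filter Module
open Literature.Geometry.Lorentzian Literature.Geometry.Riemannian

namespace Summit.SmoothPoincare4.SmoothPoincare4.Theorems.NoncompactShrinkerGapMW

/-- **Stub `helper_mwPotentialProper` — the potential of a complete shrinker is proper**
(Haslhofer–Müller 2011, Lemma 2.1), any dimension `n`: on a complete connected gradient shrinker
`Ric + Hess f = ½ g` normalised by `R + |∇f|² = f`, with `R ≥ 0`, every sub-level set `{f ≤ c}`
is compact (closed, inside a closed ball about a minimum point of `f` by the growth
`¼ (d − 5n)₊² ≤ f`); `Shrinker.isCompact_potential_le` at the model `𝓡 n`.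
[cite: HaslhoferMuller2011, Lemma 2.1 (p. 5)] -/
theorem helper_mwPotentialProper : ∀ (n : ℕ) (M : Type) [TopologicalSpace M] [T2Space M] [SecondCountableTopology M] [ChartedSpace (EuclideanSpace ℝ (Fin n)) M] [IsManifold (𝓡 n) ∞ M] [ConnectedSpace M] [T3Space M] (g : PseudoRiemannianMetric (𝓡 n) ∞ (EuclideanSpace ℝ (Fin n)) (TangentSpace (𝓡 n) : M → Type _)) [g.HasLeviCivita] (f : M → ℝ) (hg : g.IsRiemannian), (∀ (x : M) (r : NNReal), IsCompact {y : M | g.edist hg x y ≤ r}) → ContMDiff (𝓡 n) 𝓘(ℝ, ℝ) ∞ f → (∀ (x : M) (X Y : TangentSpace (𝓡 n) x), g.ricci x X Y + g.hessian f x X Y = (1 / 2 : ℝ) * g.val x X Y) → (∀ x : M, g.scalarCurvature x + g.gradSq f x = f x) → (∀ x : M, 0 ≤ g.scalarCurvature x) → ∀ c : ℝ, IsCompact {y : M | f y ≤ c} :=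
  fun _ _ _ _ _ _ _ _ _ g _ _ hg hcpl hf hsol hnorm hR0 c ↦
    Shrinker.isCompact_potential_le g hg hcpl hf hsol hnorm hR0 c

end Summit.SmoothPoincare4.SmoothPoincare4.Theorems.NoncompactShrinkerGapMW

end
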